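import Literature.Analysis.FunctionSpaces.ContDiffHolderLocalization
import Literature.Analysis.FunctionSpaces.ContDiffHolderClosedGraph
import HarnessLib

/-!
# Chart restriction and extension operators on `C^{k,r}_𝔄(M)` (Hölder spaces, part 11)

Topic `Literature/Analysis/FunctionSpaces`. For Hölder chart data `𝔄` on a compact manifold `M`
(part 4, `HolderSpaceManifold.lean`), a chart index `i` and a `C^∞` cutoff `η : E → ℝ` with
compact support inside the `i`-th chart target, we construct the two bounded operators by which
analysis on `M` is reduced to analysis on the model space (Gilbarg–Trudinger 2001, §6.2;
Joyce 2007, §1.2):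

* **restriction** `chartRestrictCLM 𝔄 hr i η … : C^{k,r}_𝔄(M, F) →L[ℝ] C^{k,r}_b(E, F)`,
  `u ↦ (y ↦ η y • u (chart_i⁻¹ y))` — membership `memContDiffHolder_smul_comp_symm` by writing
  `u = ∑ j ρ_j u` and reading `ρ_j u` through the `j`-th piece and the transition map
  `chart_j ∘ chart_i⁻¹` (smooth on an open set; localized pre-composition, part 10);
* **extension** `chartExtendCLM 𝔄 hr i η … : C^{k,r}_b(E, F) →L[ℝ] C^{k,r}_𝔄(M, F)`,
  `v ↦ 𝟙_{source_i} · (η v) ∘ chart_i` — membership `memContDiffHolder_piece_extendByZero`: the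
  `j`-th piece of the extension is a cutoff times `(η v) ∘ (chart_i ∘ chart_j⁻¹)`.

Continuity is automatic (closed graph, part 9). Everything is proved; no named facts. The model
and target spaces are taken in universe `0` (parts 5, 10). Brick (1d-i) of the census of
`Literature.Geometry.Riemannian.gurskyViaclovsky_pathOpen_weighted_four`.

## References

* D. Gilbarg, N. S. Trudinger, *Elliptic Partial Differential Equations of Second Order* (2001),
  §6.2. [GilbargTrudinger2001]
* D. Joyce, *Riemannian Holonomy Groups and Calibrated Geometry* (2007), §1.2. [Joyce2007]
-/

noncomputable section

open Set Filter Topology Function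
open scoped NNReal Manifold ContDiff

namespace Literature.Analysis.FunctionSpaces

/-! ### Finite sums of members -/

section Sum

variable {E F : Type*} [NormedAddCommGroup E] [NormedSpace ℝ E] [NormedAddCommGroup F]
  [NormedSpace ℝ F] {k : ℕ} {r : ℝ≥0}

/-- `MemContDiffHolder` is closed under finite sums. [folklore] -/
theorem MemContDiffHolder.finset_sum {α : Type*} (s : Finset α) {f : α → E → F}
    (h : ∀ a ∈ s, MemContDiffHolder k r (f a)) :
    MemContDiffHolder k r fun y => ∑ a ∈ s, f a y := by
  classical
  induction s using Finset.induction_on with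
  | empty =>
    simp only [Finset.sum_empty]
    exact memContDiffHolder_zero_fun
  | insert a s ha ih =>
    simp only [Finset.sum_insert ha]
    exact (h a (Finset.mem_insert_self a s)).add
      (ih fun b hb => h b (Finset.mem_insert_of_mem hb))

end Sum

/-! ### Transition maps -/

namespace HolderChartData

variable {ι : Type*} {E : Type*} [NormedAddCommGroup E] [NormedSpace ℝ E]
  {M : Type*} [TopologicalSpace M] [ChartedSpace E M] [IsManifold 𝓘(ℝ, E) ∞ M]
  (𝔄 : HolderChartData ι E M)

/-- The domain of the transition map `chart_j ∘ chart_i⁻¹`. [folklore] -/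
def transDomain (i j : ι) : Set E := (𝔄.chart i).target ∩ (𝔄.chart i).symm ⁻¹' (𝔄.chart j).source

omit [IsManifold 𝓘(ℝ, E) ∞ M] in
/-- The transition domain is open. [folklore] -/
theorem isOpen_transDomain (i j : ι) : IsOpen (𝔄.transDomain i j) :=
  (𝔄.chart i).continuousOn_symm.isOpen_inter_preimage (𝔄.chart i).open_target
    (𝔄.chart j).open_source

/-- **Transition maps are smooth** on their domain. [folklore] -/
theorem contDiffOn_trans (i j : ι) :
    ContDiffOn ℝ ∞ (𝔄.chart j ∘ (𝔄.chart i).symm) (𝔄.transDomain i j) := by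
  rw [← contMDiffOn_iff_contDiffOn]
  have h1 : ContMDiffOn 𝓘(ℝ, E) 𝓘(ℝ, E) ∞ (𝔄.chart j) (𝔄.chart j).source := contMDiffOn_chart
  have h2 : ContMDiffOn 𝓘(ℝ, E) 𝓘(ℝ, E) ∞ (𝔄.chart i).symm (𝔄.chart i).target :=
    contMDiffOn_chart_symm
  exact h1.comp (h2.mono inter_subset_left) fun y hy => hy.2

end HolderChartData

/-! ### Restriction to a chart -/

section Restrict

variable {ι : Type*} [Fintype ι] {E : Type} [NormedAddCommGroup E] [NormedSpace ℝ E]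
  [FiniteDimensional ℝ E] {M : Type*} [TopologicalSpace M] [ChartedSpace E M]
  [IsManifold 𝓘(ℝ, E) ∞ M] (𝔄 : HolderChartData ι E M)
  {F : Type} [NormedAddCommGroup F] [NormedSpace ℝ F] {k : ℕ} {r : ℝ≥0}

omit [Fintype ι] in
/-- **One summand of the restriction**: for `u ∈ C^{k,r}_𝔄(M, F)` and a cutoff `η` with compact
support in the `i`-th chart target, `y ↦ η y • (ρ_j u)(chart_i⁻¹ y)` is in `C^{k,r}_b(E, F)` — it is
`χ • (piece_j u) ∘ (chart_j ∘ chart_i⁻¹)` for a cutoff `χ` with compact support in the transition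
domain. [cite: GilbargTrudinger2001, §6.2] -/
theorem memContDiffHolder_smul_rho_comp_symm (hr : r ≤ 1) (u : HolderManifoldFunction 𝔄 F k r)
    (i j : ι) {η : E → ℝ} (hη : ContDiff ℝ ∞ η) (hηs : HasCompactSupport η)
    (hηt : tsupport η ⊆ (𝔄.chart i).target) :
    MemContDiffHolder k r fun y =>
      η y • (𝔄.ρ j ((𝔄.chart i).symm y) • u ((𝔄.chart i).symm y)) := by
  -- the compact set where the summand may be nonzero, inside the transition domain
  set K : Set E := tsupport η ∩ (𝔄.chart i).symm ⁻¹' tsupport (𝔄.ρ j) with hK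
  have hKc : IsCompact K := by
    refine hηs.of_isClosed_subset ?_ inter_subset_left
    exact ((𝔄.chart i).continuousOn_symm.mono hηt).preimage_isClosed_of_isClosed
      (isClosed_tsupport _) (isClosed_tsupport _)
  have hKU : K ⊆ 𝔄.transDomain i j := fun y hy =>
    ⟨hηt hy.1, 𝔄.isSubordinate j hy.2⟩
  obtain ⟨θ, hθ, hθs, hθU, hθ1, -⟩ :=
    exists_contDiff_one_nhdsSet_of_isCompact hKc (𝔄.isOpen_transDomain i j) hKU
  -- the cutoff `χ = η θ`
  have hχ : ContDiff ℝ ∞ fun y => η y * θ y := hη.mul hθ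
  have hχs : HasCompactSupport fun y => η y * θ y := hηs.mul_right
  have hχU : tsupport (fun y => η y * θ y) ⊆ 𝔄.transDomain i j :=
    (tsupport_mul_subset_right (f := η) (g := θ)).trans hθU
  have hmem := MemContDiffHolder.smul_comp_of_contDiffOn hr (u.memContDiffHolder_piece j)
    (𝔄.isOpen_transDomain i j) (𝔄.contDiffOn_trans i j) hχ hχs hχU
  -- the two functions agree
  have heq : (fun y => η y • (𝔄.ρ j ((𝔄.chart i).symm y) • u ((𝔄.chart i).symm y))) =
      fun y => (η y * θ y) • 𝔄.piece (u : M → F) j ((𝔄.chart j ∘ (𝔄.chart i).symm) y) := by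
    funext y
    by_cases hηy : η y = 0
    · simp [hηy]
    have hyη : y ∈ tsupport η := subset_closure (mem_support.2 hηy)
    by_cases hρ : (𝔄.chart i).symm y ∈ tsupport (𝔄.ρ j)
    · -- on `K`: `θ = 1` and the piece is `ρ_j u`
      have hyK : y ∈ K := ⟨hyη, hρ⟩
      have h1 : θ y = 1 := hθ1.self_of_nhdsSet y hyK
      have hsrc : (𝔄.chart i).symm y ∈ (𝔄.chart j).source := 𝔄.isSubordinate j hρ
      rw [h1, mul_one, comp_apply, ← 𝔄.smul_apply_eq_piece (u : M → F) hsrc]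
    · -- off `tsupport ρ_j`: both sides vanish
      have hρ0 : 𝔄.ρ j ((𝔄.chart i).symm y) = 0 := image_eq_zero_of_notMem_tsupport hρ
      rw [hρ0, zero_smul, smul_zero]
      by_cases hθy : θ y = 0
      · simp [hθy]
      · have hyU : y ∈ 𝔄.transDomain i j := hθU (subset_closure (mem_support.2 hθy))
        rw [comp_apply, ← 𝔄.smul_apply_eq_piece (u : M → F) hyU.2, hρ0, zero_smul, smul_zero]
  rw [heq]
  exact hmem

/-- **Restriction to a chart preserves the Hölder class**: for `u ∈ C^{k,r}_𝔄(M, F)` and a `C^∞`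
cutoff `η` with compact support inside the `i`-th chart target,
`y ↦ η y • u (chart_i⁻¹ y) ∈ C^{k,r}_b(E, F)` (`r ≤ 1`). [cite: GilbargTrudinger2001, §6.2] -/
theorem memContDiffHolder_smul_comp_symm (hr : r ≤ 1) (u : HolderManifoldFunction 𝔄 F k r)
    (i : ι) {η : E → ℝ} (hη : ContDiff ℝ ∞ η) (hηs : HasCompactSupport η)
    (hηt : tsupport η ⊆ (𝔄.chart i).target) :
    MemContDiffHolder k r fun y => η y • u ((𝔄.chart i).symm y) := by
  have heq : (fun y => η y • u ((𝔄.chart i).symm y)) = fun y =>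
      ∑ j, η y • (𝔄.ρ j ((𝔄.chart i).symm y) • u ((𝔄.chart i).symm y)) := by
    funext y
    rw [← Finset.smul_sum, 𝔄.sum_smul_eq]
  rw [heq]
  exact MemContDiffHolder.finset_sum _ fun j _ =>
    memContDiffHolder_smul_rho_comp_symm 𝔄 hr u i j hη hηs hηt

/-- The restriction as a linear map. [folklore] -/
def chartRestrictₗ (hr : r ≤ 1) (i : ι) (η : E → ℝ) (hη : ContDiff ℝ ∞ η)
    (hηs : HasCompactSupport η) (hηt : tsupport η ⊆ (𝔄.chart i).target) :
    HolderManifoldFunction 𝔄 F k r →ₗ[ℝ] ContDiffHolderFunction E F k r where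
  toFun u := ⟨fun y => η y • u ((𝔄.chart i).symm y),
    memContDiffHolder_smul_comp_symm 𝔄 hr u i hη hηs hηt⟩
  map_add' u v := ContDiffHolderFunction.ext fun y => by
    simp [smul_add]
  map_smul' a u := ContDiffHolderFunction.ext fun y => by
    simp [smul_comm (η y) a]

/-- **The chart restriction operator** `C^{k,r}_𝔄(M, F) →L[ℝ] C^{k,r}_b(E, F)`,
`u ↦ (y ↦ η y • u (chart_i⁻¹ y))` (bounded by the closed graph theorem, part 9).
[cite: GilbargTrudinger2001, §6.2] -/
def chartRestrictCLM [CompleteSpace F] (hr : r ≤ 1) (i : ι) (η : E → ℝ) (hη : ContDiff ℝ ∞ η)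
    (hηs : HasCompactSupport η) (hηt : tsupport η ⊆ (𝔄.chart i).target) :
    HolderManifoldFunction 𝔄 F k r →L[ℝ] ContDiffHolderFunction E F k r :=
  ContDiffHolderFunction.clmOfContinuousEval (chartRestrictₗ 𝔄 hr i η hη hηs hηt) fun y =>
    (HolderManifoldFunction.continuous_eval ((𝔄.chart i).symm y)).const_smul (η y)

/-- Pointwise: `chartRestrictCLM … u y = η y • u (chart_i⁻¹ y)`. [folklore] -/
@[simp]
theorem chartRestrictCLM_apply [CompleteSpace F] (hr : r ≤ 1) (i : ι) (η : E → ℝ)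
    (hη : ContDiff ℝ ∞ η) (hηs : HasCompactSupport η) (hηt : tsupport η ⊆ (𝔄.chart i).target)
    (u : HolderManifoldFunction 𝔄 F k r) (y : E) :
    chartRestrictCLM 𝔄 hr i η hη hηs hηt u y = η y • u ((𝔄.chart i).symm y) := rfl

end Restrict

/-! ### Extension from a chart -/

namespace HolderChartData

variable {ι : Type*} {E : Type*} [NormedAddCommGroup E] [NormedSpace ℝ E]
  {M : Type*} [TopologicalSpace M] [ChartedSpace E M] (𝔄 : HolderChartData ι E M)
  {F : Type*} [Zero F]

/-- **Extension by zero from the `i`-th chart**: `extendByZero 𝔄 i v = 𝟙_{source_i} · v ∘ chart_i`.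
[folklore] -/
def extendByZero (i : ι) (v : E → F) : M → F :=
  (𝔄.chart i).source.indicator fun x => v (𝔄.chart i x)

/-- The extension on the chart source. [folklore] -/
theorem extendByZero_apply_of_mem (i : ι) (v : E → F) {x : M} (hx : x ∈ (𝔄.chart i).source) :
    𝔄.extendByZero i v x = v (𝔄.chart i x) :=
  indicator_of_mem hx _

/-- The extension vanishes off the chart source. [folklore] -/
theorem extendByZero_apply_of_not_mem (i : ι) (v : E → F) {x : M} (hx : x ∉ (𝔄.chart i).source) :
    𝔄.extendByZero i v x = 0 :=
  indicator_of_notMem hx _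

end HolderChartData

section Extend

variable {ι : Type*} [Fintype ι] {E : Type} [NormedAddCommGroup E] [NormedSpace ℝ E]
  [FiniteDimensional ℝ E] {M : Type*} [TopologicalSpace M] [ChartedSpace E M]
  [IsManifold 𝓘(ℝ, E) ∞ M] [CompactSpace M] [T2Space M] (𝔄 : HolderChartData ι E M)
  {F : Type} [NormedAddCommGroup F] [NormedSpace ℝ F] {k : ℕ} {r : ℝ≥0}

omit [Fintype ι] in
/-- **The pieces of an extension by zero are in the Hölder class**: for `v ∈ C^{k,r}_b(E, F)` with
compact support inside the `i`-th chart target, the `j`-th piece of `extendByZero 𝔄 i v` is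
`χ • v ∘ (chart_i ∘ chart_j⁻¹)` for a cutoff `χ` (a bump times the `j`-th piece of `1`) with compact
support in the transition domain, hence in `C^{k,r}_b(E, F)` (`r ≤ 1`). [cite: GilbargTrudinger2001, §6.2] -/
theorem memContDiffHolder_piece_extendByZero (hr : r ≤ 1) (i j : ι) {v : E → F}
    (hv : MemContDiffHolder k r v) (hvs : HasCompactSupport v)
    (hvt : tsupport v ⊆ (𝔄.chart i).target) :
    MemContDiffHolder k r (𝔄.piece (𝔄.extendByZero i v) j) := by
  -- the compact sets
  set C : Set M := (𝔄.chart i).symm '' tsupport v with hC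
  have hCc : IsCompact C := hvs.image_of_continuousOn ((𝔄.chart i).continuousOn_symm.mono hvt)
  have hCsrc : C ⊆ (𝔄.chart i).source := by
    rintro _ ⟨y, hy, rfl⟩
    exact (𝔄.chart i).map_target (hvt hy)
  obtain ⟨hK'c, hK't⟩ := 𝔄.isCompact_image_tsupport j
  set L : Set E := 𝔄.chart j '' tsupport (𝔄.ρ j) ∩ (𝔄.chart j).symm ⁻¹' C with hL
  have hLc : IsCompact L := by
    refine hK'c.of_isClosed_subset ?_ inter_subset_left
    exact ((𝔄.chart j).continuousOn_symm.mono hK't).preimage_isClosed_of_isClosed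
      hK'c.isClosed hCc.isClosed
  have hLV : L ⊆ 𝔄.transDomain j i := fun z hz => ⟨hK't hz.1, hCsrc hz.2⟩
  obtain ⟨θ, hθ, hθs, hθV, hθ1, -⟩ :=
    exists_contDiff_one_nhdsSet_of_isCompact hLc (𝔄.isOpen_transDomain j i) hLV
  -- the `j`-th piece of the constant `1` and the cutoff `χ = θ · piece_j 1`
  set p1 : E → ℝ := 𝔄.piece (fun _ : M => (1 : ℝ)) j with hp1
  have hp1s : ContDiff ℝ ∞ p1 := 𝔄.contDiff_piece contMDiff_const j
  have hp1c : HasCompactSupport p1 := 𝔄.hasCompactSupport_piece _ j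
  have hχ : ContDiff ℝ ∞ fun z => θ z * p1 z := hθ.mul hp1s
  have hχs : HasCompactSupport fun z => θ z * p1 z := hp1c.mul_left
  have hχV : tsupport (fun z => θ z * p1 z) ⊆ 𝔄.transDomain j i :=
    (tsupport_mul_subset_left (f := θ) (g := p1)).trans hθV
  have hmem := MemContDiffHolder.smul_comp_of_contDiffOn hr hv (𝔄.isOpen_transDomain j i)
    (𝔄.contDiffOn_trans j i) hχ hχs hχV
  -- the two functions agree
  have heq : 𝔄.piece (𝔄.extendByZero i v) j =
      fun z => (θ z * p1 z) • v ((𝔄.chart i ∘ (𝔄.chart j).symm) z) := by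
    funext z
    by_cases hz : z ∈ (𝔄.chart j).target
    · have hp1z : p1 z = 𝔄.ρ j ((𝔄.chart j).symm z) := by
        rw [hp1, 𝔄.piece_apply_of_mem _ hz, smul_eq_mul, mul_one]
      rw [𝔄.piece_apply_of_mem _ hz, hp1z, comp_apply]
      set x := (𝔄.chart j).symm z with hx
      by_cases hxs : x ∈ (𝔄.chart i).source
      · rw [𝔄.extendByZero_apply_of_mem i v hxs]
        by_cases hρ : 𝔄.ρ j x = 0
        · simp [hρ]
        by_cases hvx : v (𝔄.chart i x) = 0
        · simp [hvx]
        -- here `z ∈ L`, so `θ z = 1`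
        have hzK' : z ∈ 𝔄.chart j '' tsupport (𝔄.ρ j) :=
          ⟨x, subset_closure (mem_support.2 hρ), by rw [hx, (𝔄.chart j).right_inv hz]⟩
        have hxC : x ∈ C :=
          ⟨𝔄.chart i x, subset_closure (mem_support.2 hvx), (𝔄.chart i).left_inv hxs⟩
        have h1 : θ z = 1 := hθ1.self_of_nhdsSet z ⟨hzK', hxC⟩
        rw [h1, one_mul]
      · rw [𝔄.extendByZero_apply_of_not_mem i v hxs, smul_zero]
        by_cases hθz : θ z = 0
        · simp [hθz]
        · exact absurd (hθV (subset_closure (mem_support.2 hθz))).2 hxs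
    · have hp1z : p1 z = 0 := 𝔄.piece_apply_of_not_mem _ hz
      rw [𝔄.piece_apply_of_not_mem _ hz, hp1z, mul_zero, zero_smul]
  rw [heq]
  exact hmem

/-- **Extension by zero of a compactly supported member is in `C^{k,r}_𝔄(M, F)`.** [folklore] -/
def HolderManifoldFunction.extendByZero (hr : r ≤ 1) (i : ι) (v : E → F)
    (hv : MemContDiffHolder k r v) (hvs : HasCompactSupport v)
    (hvt : tsupport v ⊆ (𝔄.chart i).target) : HolderManifoldFunction 𝔄 F k r :=
  ⟨𝔄.extendByZero i v, fun j => memContDiffHolder_piece_extendByZero 𝔄 hr i j hv hvs hvt⟩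

omit [Fintype ι] in
/-- The underlying function of the bundled extension. [folklore] -/
@[simp]
theorem HolderManifoldFunction.coe_extendByZero (hr : r ≤ 1) (i : ι) (v : E → F)
    (hv : MemContDiffHolder k r v) (hvs : HasCompactSupport v)
    (hvt : tsupport v ⊆ (𝔄.chart i).target) :
    ((HolderManifoldFunction.extendByZero 𝔄 hr i v hv hvs hvt : HolderManifoldFunction 𝔄 F k r) :
      M → F) = 𝔄.extendByZero i v := rfl

omit [Fintype ι] [FiniteDimensional ℝ E] [IsManifold 𝓘(ℝ, E) ∞ M] [CompactSpace M] [T2Space M] in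
/-- A cutoff times a member is a member. [folklore] -/
theorem memContDiffHolder_cutoff_smul (hr : r ≤ 1) {η : E → ℝ} (hη : ContDiff ℝ ∞ η)
    (hηs : HasCompactSupport η) (v : ContDiffHolderFunction E F k r) :
    MemContDiffHolder k r fun y => η y • v y :=
  (MemContDiffHolder.of_contDiff_of_hasCompactSupport hη hηs hr).bilinear hr
    (ContinuousLinearMap.lsmul ℝ ℝ) v.memContDiffHolder

/-- The extension operator as a linear map. [folklore] -/
def chartExtendₗ (hr : r ≤ 1) (i : ι) (η : E → ℝ) (hη : ContDiff ℝ ∞ η)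
    (hηs : HasCompactSupport η) (hηt : tsupport η ⊆ (𝔄.chart i).target) :
    ContDiffHolderFunction E F k r →ₗ[ℝ] HolderManifoldFunction 𝔄 F k r where
  toFun v := HolderManifoldFunction.extendByZero 𝔄 hr i (fun y => η y • v y)
    (memContDiffHolder_cutoff_smul hr hη hηs v) hηs.smul_right
    ((tsupport_smul_subset_left η v).trans hηt)
  map_add' v w := HolderManifoldFunction.ext fun x => by
    by_cases hx : x ∈ (𝔄.chart i).source
    · simp [HolderChartData.extendByZero_apply_of_mem _ i _ hx, smul_add]
    · simp [HolderChartData.extendByZero_apply_of_not_mem _ i _ hx]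
  map_smul' a v := HolderManifoldFunction.ext fun x => by
    by_cases hx : x ∈ (𝔄.chart i).source
    · simp [HolderChartData.extendByZero_apply_of_mem _ i _ hx, smul_comm (η _) a]
    · simp [HolderChartData.extendByZero_apply_of_not_mem _ i _ hx]

/-- **The chart extension operator** `C^{k,r}_b(E, F) →L[ℝ] C^{k,r}_𝔄(M, F)`,
`v ↦ 𝟙_{source_i} · (η v) ∘ chart_i` (bounded by the closed graph theorem, part 9).
[cite: GilbargTrudinger2001, §6.2] -/
def chartExtendCLM [CompleteSpace F] (hr : r ≤ 1) (i : ι) (η : E → ℝ) (hη : ContDiff ℝ ∞ η)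
    (hηs : HasCompactSupport η) (hηt : tsupport η ⊆ (𝔄.chart i).target) :
    ContDiffHolderFunction E F k r →L[ℝ] HolderManifoldFunction 𝔄 F k r :=
  HolderManifoldFunction.clmOfContinuousEval (chartExtendₗ 𝔄 hr i η hη hηs hηt) fun x => by
    by_cases hx : x ∈ (𝔄.chart i).source
    · have heq : (fun v : ContDiffHolderFunction E F k r => chartExtendₗ 𝔄 hr i η hη hηs hηt v x) =
          fun v => η (𝔄.chart i x) • v (𝔄.chart i x) := by
        funext v
        show 𝔄.extendByZero i (fun y => η y • v y) x = _
        exact HolderChartData.extendByZero_apply_of_mem _ i _ hx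
      rw [heq]
      exact (ContDiffHolderFunction.evalCLM (E := E) (F := F) (k := k) (r := r)
        (𝔄.chart i x)).continuous.const_smul _
    · have heq : (fun v : ContDiffHolderFunction E F k r => chartExtendₗ 𝔄 hr i η hη hηs hηt v x) =
          fun _ => (0 : F) := by
        funext v
        show 𝔄.extendByZero i (fun y => η y • v y) x = 0
        exact HolderChartData.extendByZero_apply_of_not_mem _ i _ hx
      rw [heq]
      exact continuous_const

/-- Pointwise: `chartExtendCLM … v x = 𝟙_{source_i}(x) · η (chart_i x) • v (chart_i x)`. [folklore] -/
theorem chartExtendCLM_apply [CompleteSpace F] (hr : r ≤ 1) (i : ι) (η : E → ℝ)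
    (hη : ContDiff ℝ ∞ η) (hηs : HasCompactSupport η) (hηt : tsupport η ⊆ (𝔄.chart i).target)
    (v : ContDiffHolderFunction E F k r) (x : M) :
    chartExtendCLM 𝔄 hr i η hη hηs hηt v x = 𝔄.extendByZero i (fun y => η y • v y) x := rfl

/-- **Restriction after extension**: on the chart target, restricting the extension of `v` with
cutoff `η'` returns `η' · η · v`. [folklore] -/
theorem chartRestrictCLM_chartExtendCLM_apply [CompleteSpace F] (hr : r ≤ 1) (i : ι)
    (η η' : E → ℝ) (hη : ContDiff ℝ ∞ η) (hηs : HasCompactSupport η)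
    (hηt : tsupport η ⊆ (𝔄.chart i).target) (hη' : ContDiff ℝ ∞ η') (hη's : HasCompactSupport η')
    (hη't : tsupport η' ⊆ (𝔄.chart i).target) (v : ContDiffHolderFunction E F k r) {y : E}
    (hy : y ∈ (𝔄.chart i).target) :
    chartRestrictCLM 𝔄 hr i η' hη' hη's hη't (chartExtendCLM 𝔄 hr i η hη hηs hηt v) y =
      (η' y * η y) • v y := by
  rw [chartRestrictCLM_apply, chartExtendCLM_apply,
    HolderChartData.extendByZero_apply_of_mem _ i _ ((𝔄.chart i).map_target hy),
    (𝔄.chart i).right_inv hy, mul_smul]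

end Extend

end Literature.Analysis.FunctionSpaces

end
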